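import Summits.QuantumFields.YangMills.Theorems.SwapVirialDeficitBlowUpVirialChart
import Summits.QuantumFields.YangMills.Theorems.SwapVirialDeficitBlowUpGnomonicRingChartReal
import Summits.QuantumFields.YangMills.Theorems.SwapVirialDeficitSwapRingLogDerivDeficit
import HarnessLib

/-!
# THE VIRIAL IDENTITY ON THE RING (file C of the V2′ assembly of fcl-p3 g45's virial SPEC, memo2-24197-window v2 §2′):
# `b·∫ F^S_z e^{−bF^S_z} dμ_L = α·∫ e^{−bF^S_z} dμ_L − ½·K_L·⟪W⟫_{z,b} + b·K_L·⟪R⟫_{z,b}`, `α = (18L⁴ − 2)/2 = 9L⁴ − 1`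
# (free-hands support of ⟨stmt-QuantumFields-24197⟩ `SwapVirialDeficit.SwapGluedStiffness`)

The chart-side virial decomposition ✓`virial_chart_decomposition` (signs summed, hub integrated) is carried back to the ring by w2 g57's joint gnomonic ring chart
in Bochner form ✓`integral_ringMeasure_eq_gnomonic` (`∫ G dμ_L = K_L·∫ a, Σ_ε ∫ η, G(hist(a,ε,η))·ρ(η) ∂cone`, `K_L = coneConst³/64·(2π²)^{−|Fol L|}`), applied to
the two bounded seam-invariant integrands `e^{−bF^S_z}` and `F^S_z·e^{−bF^S_z}` (principal character `χ ≡ 1`, any sector `z`):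
* §1 `integral_exp_swapDeficit_eq_gnomonic` (`Z_z(b)` in the chart), `integral_swapDeficit_exp_eq_gnomonic` (`E_z(b) = ∫F e^{−bF}` in the chart);
* §2 ★★★ `virial_ring` — for every sector `z` and `b > 0`:
  `b·∫ F^S_z e^{−bF^S_z} dμ_L = (7+3|Fol L|)/2 · ∫ e^{−bF^S_z} dμ_L − ½·K_L·⟪W⟫_{z,b} + b·K_L·⟪R⟫_{z,b}`,
  `⟪W⟫_{z,b} = ∫ a, Σ_ε ∫ gnoW·e^{−bF̂_{z,a,ε}}·ρ ∂cone`, `⟪R⟫_{z,b} = ∫ a, Σ_ε ∫ (F̂ − ½XF̂)·e^{−bF̂}·ρ ∂cone`; `virial_ring'` with `(7+3|Fol L|)/2 = ((18L⁴−2 : ℕ) : ℝ)/2`.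
So `b⟨F⟩_{z,b} = α − ½⟨W⟩ + b⟨R⟩` EXACTLY in every sector: the window row of ⟨24197⟩ is the inequality `½⟪W⟫ − b⟪R⟫ ≤ (1/2 − c)·Z` summed over sectors (file D2,
✓`SwapRing.mul_deriv_log_twistTrace_eq`), i.e. UNIFORM-IN-`L` moment bounds (V4′) — OPEN.
HONEST LABEL: exact fixed-`L` identity; no estimate; ⟨24197⟩ (window-uniform) ∕ ⟨24194⟩ ∕ ⟨24196⟩ ∕ ⟨24497⟩ OPEN; the Yang–Mills mass gap is NOT proved; no summit is
proved by a line.  Seat ym-line-fcl-p3 g46 (cell ym-idea-1, free hands; item of record ⟨24085⟩ aside, untouched), `--supports stmt-QuantumFields-24197`.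
THEOREMS ONLY, 0 `sorry`, standard axioms; the series' local `ℍ` instances (`coneMeasure` lives on `ℍ`).  References: [cite: tHooft1979]; [cite: Luscher1983, §2]; [folklore].
-/

set_option autoImplicit false
set_option synthInstance.maxSize 1024

noncomputable section

open MeasureTheory Quaternion Set Filter Topology
open scoped Quaternion BigOperators
open Literature.MathematicalPhysics.QuantumLattice
open Literature.MathematicalPhysics.QuantumFieldTheory hiding SU2
open Summit.QuantumFields.YangMills.Theorems.FemtoTransferGap
open Summit.QuantumFields.YangMills.Theorems.FemtoTransferGap.TT
open Summit.QuantumFields.YangMills.Theorems.VirialFluxGap.RingDeficit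
open Summit.QuantumFields.YangMills.Theorems.SwapTwistDeficit.ToronLog (coneMeasure coneConst isProbabilityMeasure_coneMeasure)
open Summit.QuantumFields.YangMills.Theorems.SwapVirialDeficit.SwapRing

attribute [local instance] Literature.Analysis.FluidPDE.Tao2016.quatMeasurableSpace
  Literature.Analysis.FluidPDE.Tao2016.quatBorelSpace
  Literature.MathematicalPhysics.QuantumLattice.secondCountableTopology_su2

namespace Summit.QuantumFields.YangMills.Theorems.SwapVirialDeficit.BlowUpRing

variable {L : ℕ} [NeZero L]

/-! ## §1 The sector Laplace integral and mean action in the gnomonic chart -/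

omit [NeZero L] in
/-- The constant character `χ ≡ 1` is central. [folklore] -/
theorem one_central : ∀ (x : Site 3 L) (k : SU2), k * (fun _ : Site 3 L => (1 : SU2)) x = (fun _ : Site 3 L => (1 : SU2)) x * k :=
  fun _ k => by rw [mul_one, one_mul]

/-- ★ `Z_z(b) = ∫ e^{−bF^S_z} dμ_L` in the gnomonic chart (`b ≥ 0`): `= K_L · ∫ a, Σ_ε ∫ e^{−bF̂_{z,a,ε}}·ρ ∂cone`. [cite: tHooft1979] -/
theorem integral_exp_swapDeficit_eq_gnomonic (z : Fin 3 → Bool) {b : ℝ} (hb : 0 ≤ b) :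
    ∫ p, Real.exp (-(b * swapRingDeficit L z p)) ∂(ringMeasure L) =
      (coneConst ^ 3 / 64 * (1 / (2 * Real.pi ^ 2)) ^ Fintype.card (Fol L)) *
        ∫ a, (∑ ε : GnoSign L, ∫ η : GnoCoord L, Real.exp (-(b * gnoDeficit z (fun _ => 1) a ε η)) * gnoDensity η) ∂coneMeasure := by
  have h := integral_ringMeasure_eq_gnomonic (L := L) (⇑(sitePerm (L := L) (Equiv.swap (0 : Fin 3) 1))) (χ := fun _ => 1) one_central
    (G := fun p => Real.exp (-(b * swapRingDeficit L z p))) (((measurable_swapRingDeficit z).const_mul b).neg.exp) (M := 1)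
    (fun p => by
      rw [abs_of_pos (Real.exp_pos _)]
      exact Real.exp_le_one_iff.2 (by have := swapRingDeficit_nonneg (L := L) z p; nlinarith))
    (fun h p => by simp only [swapRingDeficit_seamGaugeAct])
  rw [h]
  rfl

/-- ★ `E_z(b) = ∫ F^S_z e^{−bF^S_z} dμ_L` in the gnomonic chart (`b ≥ 0`): `= K_L · ∫ a, Σ_ε ∫ F̂·e^{−bF̂}·ρ ∂cone`. [cite: tHooft1979] -/
theorem integral_swapDeficit_exp_eq_gnomonic (z : Fin 3 → Bool) {b : ℝ} (hb : 0 ≤ b) :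
    ∫ p, swapRingDeficit L z p * Real.exp (-(b * swapRingDeficit L z p)) ∂(ringMeasure L) =
      (coneConst ^ 3 / 64 * (1 / (2 * Real.pi ^ 2)) ^ Fintype.card (Fol L)) *
        ∫ a, (∑ ε : GnoSign L, ∫ η : GnoCoord L,
          gnoDeficit z (fun _ => 1) a ε η * Real.exp (-(b * gnoDeficit z (fun _ => 1) a ε η)) * gnoDensity η) ∂coneMeasure := by
  obtain ⟨B, hB⟩ := exists_abs_swapRingDeficit_le (L := L) z
  have h := integral_ringMeasure_eq_gnomonic (L := L) (⇑(sitePerm (L := L) (Equiv.swap (0 : Fin 3) 1))) (χ := fun _ => 1) one_central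
    (G := fun p => swapRingDeficit L z p * Real.exp (-(b * swapRingDeficit L z p)))
    ((measurable_swapRingDeficit z).mul ((measurable_swapRingDeficit z).const_mul b).neg.exp) (M := B)
    (fun p => by
      rw [abs_mul, abs_of_pos (Real.exp_pos _)]
      have h1 : Real.exp (-(b * swapRingDeficit L z p)) ≤ 1 :=
        Real.exp_le_one_iff.2 (by have := swapRingDeficit_nonneg (L := L) z p; nlinarith)
      calc |swapRingDeficit L z p| * Real.exp (-(b * swapRingDeficit L z p)) ≤ B * 1 :=
            mul_le_mul (hB p) h1 (Real.exp_pos _).le ((abs_nonneg _).trans (hB p))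
        _ = B := mul_one B)
    (fun h p => by simp only [swapRingDeficit_seamGaugeAct])
  rw [h]
  rfl

/-! ## §2 The virial identity on the ring -/

/-- ★★★ **THE VIRIAL IDENTITY ON THE σ-GLUED RING** (memo2-24197-window §2′ (V3′), exact, every sector `z`, every `b > 0`):
`b·∫ F^S_z e^{−bF^S_z} dμ_L = (7+3|Fol L|)/2 · ∫ e^{−bF^S_z} dμ_L − ½·K_L·⟪W⟫_{z,b} + b·K_L·⟪R⟫_{z,b}` with the chart functionals
`⟪W⟫_{z,b} = ∫ a, Σ_ε ∫ gnoW·e^{−bF̂}·ρ dη ∂cone` (second-order Euler weight) and `⟪R⟫_{z,b} = ∫ a, Σ_ε ∫ (F̂ − ½XF̂)·e^{−bF̂}·ρ dη ∂cone` (third-order remainder),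
`K_L = coneConst³/64·(2π²)^{−|Fol L|}`; i.e. `b⟨F⟩ = α − ½⟨W⟩ + b⟨R⟩`, `α = 9L⁴ − 1`. [folklore] -/
theorem virial_ring (z : Fin 3 → Bool) {b : ℝ} (hb : 0 < b) :
    b * ∫ p, swapRingDeficit L z p * Real.exp (-(b * swapRingDeficit L z p)) ∂(ringMeasure L) =
      (7 + 3 * (Fintype.card (Fol L) : ℝ)) / 2 * ∫ p, Real.exp (-(b * swapRingDeficit L z p)) ∂(ringMeasure L)
        - 1 / 2 * ((coneConst ^ 3 / 64 * (1 / (2 * Real.pi ^ 2)) ^ Fintype.card (Fol L)) *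
            ∫ a, (∑ ε : GnoSign L, ∫ η : GnoCoord L,
              gnoW η * Real.exp (-(b * gnoDeficit z (fun _ => 1) a ε η)) * gnoDensity η) ∂coneMeasure)
        + b * ((coneConst ^ 3 / 64 * (1 / (2 * Real.pi ^ 2)) ^ Fintype.card (Fol L)) *
            ∫ a, (∑ ε : GnoSign L, ∫ η : GnoCoord L,
              (gnoDeficit z (fun _ => 1) a ε η - gnoXDeficit z (fun _ => 1) a ε η / 2) *
                Real.exp (-(b * gnoDeficit z (fun _ => 1) a ε η)) * gnoDensity η) ∂coneMeasure) := by
  rw [integral_swapDeficit_exp_eq_gnomonic z hb.le, integral_exp_swapDeficit_eq_gnomonic z hb.le]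
  have hV := virial_chart_decomposition (L := L) z (fun _ => 1) hb
  set K : ℝ := coneConst ^ 3 / 64 * (1 / (2 * Real.pi ^ 2)) ^ Fintype.card (Fol L) with hK
  have e1 : b * (K * ∫ a, (∑ ε : GnoSign L, ∫ η : GnoCoord L,
      gnoDeficit z (fun _ => 1) a ε η * Real.exp (-(b * gnoDeficit z (fun _ => 1) a ε η)) * gnoDensity η) ∂coneMeasure) =
      K * (b * ∫ a, (∑ ε : GnoSign L, ∫ η : GnoCoord L,
        gnoDeficit z (fun _ => 1) a ε η * Real.exp (-(b * gnoDeficit z (fun _ => 1) a ε η)) * gnoDensity η) ∂coneMeasure) := by ring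
  rw [e1, hV]
  ring

/-- ★★★ The same with `(7 + 3|Fol L|)/2 = (18L⁴ − 2)/2 = α` (✓`two_alpha_eq`). [folklore] -/
theorem virial_ring' (z : Fin 3 → Bool) {b : ℝ} (hb : 0 < b) :
    b * ∫ p, swapRingDeficit L z p * Real.exp (-(b * swapRingDeficit L z p)) ∂(ringMeasure L) =
      ((18 * L ^ 4 - 2 : ℕ) : ℝ) / 2 * ∫ p, Real.exp (-(b * swapRingDeficit L z p)) ∂(ringMeasure L)
        - 1 / 2 * ((coneConst ^ 3 / 64 * (1 / (2 * Real.pi ^ 2)) ^ Fintype.card (Fol L)) *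
            ∫ a, (∑ ε : GnoSign L, ∫ η : GnoCoord L,
              gnoW η * Real.exp (-(b * gnoDeficit z (fun _ => 1) a ε η)) * gnoDensity η) ∂coneMeasure)
        + b * ((coneConst ^ 3 / 64 * (1 / (2 * Real.pi ^ 2)) ^ Fintype.card (Fol L)) *
            ∫ a, (∑ ε : GnoSign L, ∫ η : GnoCoord L,
              (gnoDeficit z (fun _ => 1) a ε η - gnoXDeficit z (fun _ => 1) a ε η / 2) *
                Real.exp (-(b * gnoDeficit z (fun _ => 1) a ε η)) * gnoDensity η) ∂coneMeasure) := by
  rw [virial_ring z hb, ← two_alpha_eq, cast_seven_add]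

/-- `(18L⁴ − 2)/2 = 9L⁴ − 1`: the virial constant is `α = 9L⁴ − 1`, the exponent of the fixed-`L` rung. [folklore] -/
theorem half_two_alpha_eq : ((18 * L ^ 4 - 2 : ℕ) : ℝ) / 2 = 9 * (L : ℝ) ^ 4 - 1 := by
  have h1 : 1 ≤ L := Nat.one_le_iff_ne_zero.2 (NeZero.ne L)
  have h4 : 1 ≤ L ^ 4 := Nat.one_le_pow _ _ h1
  have h : 2 ≤ 18 * L ^ 4 := by omega
  rw [Nat.cast_sub h]
  push_cast
  ring

end Summit.QuantumFields.YangMills.Theorems.SwapVirialDeficit.BlowUpRing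

end
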